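import Literature.Probability.Percolation.PartitionLatticeGluing
import Summits.CriticalPhenomena.PercolationContinuityZ3.Theorems.PercNearOneGluingNoHeavyLowerTailThreePointIsoSexticAllGraphs
import Summits.CriticalPhenomena.PercolationContinuityZ3.Theorems.PercNearOneGluingNoHeavyLowerTailThreePointIsoSexticEdgeNC
import HarnessLib

/-!
# The eight principal down-sets of the separator `{s,a,b,c}`: dictionary and the laws `(T)`, `(Q6)_c` valid for every weighted graph

Support file for crux `stmt-CriticalPhenomena-4575` (`NoHeavyLowerTail`), seat `prim-l12-p1` gen 32 (`--supports stmt-CriticalPhenomena-4575`);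
graph-level assembly of the `∥`-stability theorems (lead gen 134 spec `run/shared/lean/prim/prim-nh-lead-4575/GRAPH-LEVEL-SPEC-g134.md`),
part 1 of 3 (part 2: `…SuperTerminalDownsetEvents`, part 3: `…SuperTerminalP3HalfGluing`).  No definitions, no sorries, standard axioms.

Setting: bond percolation `prodBernoulli u` on a finite vertex type `V`, four pairwise distinct terminals `s a b c` (root `s`, block partner
`a`, singleton `b`, port `c`).  The cell-level stability theorems (`SuperTerminalP3HalfStable.dvec_p3half_mul`, `SuperTerminalQuarticOrdered`,
`SuperTerminalP3LamStable`) are stated in the eight PRINCIPAL DOWN-SET probabilities of the partition lattice of `T₄ = {s,a,b,c}` —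
`d0 = D(s|a|b|c)`, `d1 = D(sa|b|c)`, `d2 = D(sa|bc)`, `d3 = D(s|a|bc)`, `d4 = D(sac|b)`, `d5 = D(sc|a|b)`, `d6 = D(ac|s|b)`, `d7 = D(c|sab)` —
because these MULTIPLY under gluing at `T₄` (splitting formula `Literature.Probability.Percolation.PartitionGluing.real_partLE`,
[BeicheltTittmann2012, Thm. 7.5]).  This file supplies, uniformly for every weight `u` on `V`:

* `mem_partLE_insert`, `partLE_singleton` — unfolding `partLE` (= `π|_T ≤ blk`) one terminal at a time;
* `preimage_insert_partLE`, `real_partLE_update_eq`, `real_partLE_update_one` — a SURE terminal pair inside a block: opening `s(s,a)` maps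
  `π|_T ≤ blk` onto `π|_{T ∪ {a}} ≤ blk` when `blk s = blk a` [BeicheltTittmann2012, proof of Thm. 7.6: `G ∪ H_σ` induces `π ∨ σ`], and the
  probability of such a down-set does not depend on the weight of `s(s,a)` (one-pair pivot `ThreePointIsoSexticEdgeNC.real_update_eq`);
* `partLE_blk0` … `partLE_blk7` (and the three-terminal `partLE3_blk1/2/4/7`) — the dictionary: each `partLE T₄ blkₖ` (explicit block
  labelling) is an explicit intersection of non-connection events `(x ↔ y)ᶜ`; e.g. `D(c|sab)` is the event `c ∤ {s,a,b}` of `SuperTerminalQuarticFace`;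
* `quartic_law`, `sextic_law` — **for EVERY weight `u`**: `d1⁴ ≤ d2²d4²d7` (the tropical law `(T)`) and `d1⁶ ≤ d7²d2³d4³` (`(Q6)_c`): the tree's
  `isoQuartic_graph` / `isoSexticPort_all` for the weight with `s(s,a)` made sure, transported back by the sure-pair lemmas.
-/

namespace Summit.CriticalPhenomena.PercolationContinuityZ3.Theorems.SuperTerminalDownsets

open MeasureTheory Set
open Literature.Probability.Percolation Literature.Probability.Percolation.PartitionGluing
open Literature.Probability.LatticeModels (prodBernoulli)
open scoped Classical

variable {V : Type*} [Fintype V]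

/-! ## Unfolding principal down-sets of small separators -/

section Unfold
variable {κ : Type*}

omit [Fintype V] in
/-- Symmetry of `{x ↔ y}` (membership form, for rewriting). [folklore] -/
theorem mem_openConn_comm {x y : V} {ω : BondConfig V} : ω ∈ openConn x y ↔ ω ∈ openConn y x :=
  ⟨LonePortSum.mem_openConn_symm, LonePortSum.mem_openConn_symm⟩

omit [Fintype V] in
/-- A one-point separator imposes no condition: `partLE {x} blk = univ`. [folklore] -/
theorem partLE_singleton (x : V) (blk : V → κ) : partLE ({x} : Finset V) blk = univ := by
  refine eq_univ_of_forall fun ω p hp q hq _ => ?_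
  rw [Finset.mem_singleton] at hp hq
  rw [hp, hq]

omit [Fintype V] in
/-- Unfolding `partLE` one terminal at a time: `π|_{T ∪ {x}} ≤ blk` iff `π|_T ≤ blk` and every terminal of `T` joined to `x`
lies in the block of `x`. [folklore] -/
theorem mem_partLE_insert {T : Finset V} {x : V} {blk : V → κ} {ω : BondConfig V} :
    ω ∈ partLE (insert x T) blk ↔ (∀ t ∈ T, ω ∈ openConn x t → blk x = blk t) ∧ ω ∈ partLE T blk := by
  constructor
  · intro h
    exact ⟨fun t ht hxt => h x (Finset.mem_insert_self x T) t (Finset.mem_insert_of_mem ht) hxt,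
      fun p hp q hq hpq => h p (Finset.mem_insert_of_mem hp) q (Finset.mem_insert_of_mem hq) hpq⟩
  · rintro ⟨hx, hT⟩ p hp q hq hpq
    rcases Finset.mem_insert.1 hp with rfl | hp' <;> rcases Finset.mem_insert.1 hq with rfl | hq'
    · rfl
    · exact hx q hq' hpq
    · exact (hx p hp' (LonePortSum.mem_openConn_symm hpq)).symm
    · exact hT p hp' q hq' hpq

end Unfold

/-! ## A sure terminal pair inside a block (`G ∪ H_σ`, `σ ≤ blk`) -/

section SureEdge
variable {κ : Type*} {T : Finset V} {s a : V} {blk : V → κ}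

omit [Fintype V] in
/-- **Opening the terminal pair `s(s,a)` inside a block.**  If `s ∈ T` and `blk s = blk a`, a configuration `ω` satisfies
`π(ω ∪ {sa})|_T ≤ blk` iff `π(ω)|_{T ∪ {a}} ≤ blk`: gluing the sure edge `H_σ = {sa}` (`σ ≤ blk`) realises `π ∨ σ`, and
`π ∨ σ ≤ blk ⇔ π ≤ blk` on the enlarged separator. [cite: BeicheltTittmann2012, §7.2, proof of Thm. 7.6 p. 169 (G¹ ∪ H_σ induces π ∨ σ)] -/
theorem preimage_insert_partLE (hs : s ∈ T) (hbl : blk s = blk a) :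
    {ω : BondConfig V | insert s(s, a) ω ∈ partLE T blk} = partLE (insert a T) blk := by
  ext ω
  simp only [mem_setOf_eq]
  constructor
  · intro h x hx y hy hxy
    have lift : ∀ {p q : V}, ω ∈ openConn p q → insert s(s, a) ω ∈ openConn p q := fun h =>
      SimpleGraph.Reachable.mono (openGraph_mono (subset_insert _ _)) h
    have hsa : insert s(s, a) ω ∈ openConn s a :=
      (ThreePointIsoSexticEdgeNC.reachable_insert_iff s a).2
        (Or.inr (Or.inl ⟨SimpleGraph.Reachable.refl _, SimpleGraph.Reachable.refl _⟩))
    rcases Finset.mem_insert.1 hx with rfl | hx' <;> rcases Finset.mem_insert.1 hy with rfl | hy'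
    · rfl
    · rw [← hbl]
      exact h s hs y hy' (LonePortSum.mem_openConn_trans hsa (lift hxy))
    · rw [← hbl]
      exact h x hx' s hs (LonePortSum.mem_openConn_trans (lift hxy) (LonePortSum.mem_openConn_symm hsa))
    · exact h x hx' y hy' (lift hxy)
  · intro h x hx y hy hxy
    have hx' : x ∈ insert a T := Finset.mem_insert_of_mem hx
    have hy' : y ∈ insert a T := Finset.mem_insert_of_mem hy
    have hs' : s ∈ insert a T := Finset.mem_insert_of_mem hs
    have ha := Finset.mem_insert_self a T
    rcases (ThreePointIsoSexticEdgeNC.reachable_insert_iff x y).1 hxy with h1 | ⟨h1, h2⟩ | ⟨h1, h2⟩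
    · exact h x hx' y hy' h1
    · exact (h x hx' s hs' h1).trans (hbl.trans (h a ha y hy' h2))
    · exact (h x hx' a ha h1).trans (hbl.symm.trans (h s hs' y hy' h2))

/-- The probability of `π|_T ≤ blk` does not depend on the weight of a terminal pair `s(s,a)` inside a block (`s, a ∈ T`,
`blk s = blk a`): one-pair pivot + `preimage_insert_partLE`. [cite: BeicheltTittmann2012, §7.2, proof of Thm. 7.6 p. 169] -/
theorem real_partLE_update_eq (u : Sym2 V → unitInterval) (r : unitInterval) (hs : s ∈ T) (ha : a ∈ T) (hbl : blk s = blk a) :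
    (prodBernoulli (Function.update u s(s, a) r)).real (partLE T blk) =
      (prodBernoulli (Function.update u s(s, a) 0)).real (partLE T blk) := by
  have key : {ω : BondConfig V | insert s(s, a) ω ∈ partLE T blk} = partLE T blk := by
    rw [preimage_insert_partLE hs hbl, Finset.insert_eq_of_mem ha]
  rw [ThreePointIsoSexticEdgeNC.real_update_eq u s(s, a) r (partLE T blk), key]
  ring

/-- `P_u(π|_T ≤ blk) = P_{u[sa ↦ 0]}(π|_T ≤ blk)` for a terminal pair inside a block. [cite: BeicheltTittmann2012, §7.2, proof of Thm. 7.6 p. 169] -/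
theorem real_partLE_eq_update_zero (u : Sym2 V → unitInterval) (hs : s ∈ T) (ha : a ∈ T) (hbl : blk s = blk a) :
    (prodBernoulli u).real (partLE T blk) = (prodBernoulli (Function.update u s(s, a) 0)).real (partLE T blk) := by
  conv_lhs => rw [← Function.update_eq_self s(s, a) u]
  exact real_partLE_update_eq u (u s(s, a)) hs ha hbl

/-- **Gluing the sure edge `sa`**: for `s ∈ T` and `blk s = blk a`, `P_{u[sa ↦ 1]}(π|_T ≤ blk) = P_u(π|_{T ∪ {a}} ≤ blk)` — the down-set of
the contracted/glued graph on the separator without `a` is the down-set of the original graph on the separator with `a`.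
[cite: BeicheltTittmann2012, §7.2, proof of Thm. 7.6 p. 169 (G¹_σ connected iff π ∨ σ = 1̂)] -/
theorem real_partLE_update_one (u : Sym2 V → unitInterval) (hs : s ∈ T) (hbl : blk s = blk a) :
    (prodBernoulli (Function.update u s(s, a) 1)).real (partLE T blk) = (prodBernoulli u).real (partLE (insert a T) blk) := by
  rw [ThreePointIsoSexticEdgeNC.real_update_eq u s(s, a) 1 (partLE T blk), preimage_insert_partLE hs hbl,
    real_partLE_eq_update_zero u (Finset.mem_insert_of_mem hs) (Finset.mem_insert_self a T) hbl]
  simp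

end SureEdge

/-! ## The dictionary: the eight principal down-sets of `T₄ = {s,a,b,c}` as non-connection events -/

section Four
variable {s a b c : V}

omit [Fintype V] in
/-- `D(s|a|b|c)`: all four terminals in different clusters. [this work] -/
theorem partLE_blk0 (hd : s ≠ a ∧ s ≠ b ∧ s ≠ c ∧ a ≠ b ∧ a ≠ c ∧ b ≠ c) :
    partLE ({s, a, b, c} : Finset V) (fun v => if v = a then 1 else if v = b then 2 else if v = c then 3 else (0 : ℕ)) =
      (openConn s a)ᶜ ∩ (openConn s b)ᶜ ∩ (openConn s c)ᶜ ∩ (openConn a b)ᶜ ∩ (openConn a c)ᶜ ∩ (openConn b c)ᶜ := by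
  ext ω
  simp only [mem_partLE_insert, partLE_singleton, Finset.mem_insert, Finset.mem_singleton, forall_eq_or_imp, forall_eq,
    mem_univ, and_true, mem_inter_iff, mem_compl_iff]
  simp [hd.1, hd.2.1, hd.2.2.1, hd.2.2.2.1.symm, hd.2.2.2.2.1.symm, hd.2.2.2.2.2.symm, and_assoc]

omit [Fintype V] in
/-- `D(sa|b|c)`. [this work] -/
theorem partLE_blk1 (hd : s ≠ a ∧ s ≠ b ∧ s ≠ c ∧ a ≠ b ∧ a ≠ c ∧ b ≠ c) :
    partLE ({s, a, b, c} : Finset V) (fun v => if v = b then 1 else if v = c then 2 else (0 : ℕ)) =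
      (openConn s b)ᶜ ∩ (openConn s c)ᶜ ∩ (openConn a b)ᶜ ∩ (openConn a c)ᶜ ∩ (openConn b c)ᶜ := by
  ext ω
  simp only [mem_partLE_insert, partLE_singleton, Finset.mem_insert, Finset.mem_singleton, forall_eq_or_imp, forall_eq,
    mem_univ, and_true, mem_inter_iff, mem_compl_iff]
  simp [hd.2.1, hd.2.2.1, hd.2.2.2.1, hd.2.2.2.2.1, hd.2.2.2.2.2.symm, and_assoc]

omit [Fintype V] in
/-- `D(sa|bc)`. [this work] -/
theorem partLE_blk2 (hd : s ≠ a ∧ s ≠ b ∧ s ≠ c ∧ a ≠ b ∧ a ≠ c ∧ b ≠ c) :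
    partLE ({s, a, b, c} : Finset V) (fun v => if v = b ∨ v = c then 1 else (0 : ℕ)) =
      (openConn s b)ᶜ ∩ (openConn s c)ᶜ ∩ (openConn a b)ᶜ ∩ (openConn a c)ᶜ := by
  ext ω
  simp only [mem_partLE_insert, partLE_singleton, Finset.mem_insert, Finset.mem_singleton, forall_eq_or_imp, forall_eq,
    mem_univ, and_true, mem_inter_iff, mem_compl_iff]
  simp [hd.2.1, hd.2.2.1, hd.2.2.2.1, hd.2.2.2.2.1, and_assoc]

omit [Fintype V] in
/-- `D(s|a|bc)`. [this work] -/
theorem partLE_blk3 (hd : s ≠ a ∧ s ≠ b ∧ s ≠ c ∧ a ≠ b ∧ a ≠ c ∧ b ≠ c) :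
    partLE ({s, a, b, c} : Finset V) (fun v => if v = a then 1 else if v = b ∨ v = c then 2 else (0 : ℕ)) =
      (openConn s a)ᶜ ∩ (openConn s b)ᶜ ∩ (openConn s c)ᶜ ∩ (openConn a b)ᶜ ∩ (openConn a c)ᶜ := by
  ext ω
  simp only [mem_partLE_insert, partLE_singleton, Finset.mem_insert, Finset.mem_singleton, forall_eq_or_imp, forall_eq,
    mem_univ, and_true, mem_inter_iff, mem_compl_iff]
  simp [hd.1, hd.2.1, hd.2.2.1, hd.2.2.2.1.symm, hd.2.2.2.2.1.symm, and_assoc]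

omit [Fintype V] in
/-- `D(sac|b)`: `b` isolated from `{s,a,c}`. [this work] -/
theorem partLE_blk4 (hd : s ≠ a ∧ s ≠ b ∧ s ≠ c ∧ a ≠ b ∧ a ≠ c ∧ b ≠ c) :
    partLE ({s, a, b, c} : Finset V) (fun v => if v = b then 1 else (0 : ℕ)) =
      (openConn s b)ᶜ ∩ (openConn a b)ᶜ ∩ (openConn b c)ᶜ := by
  ext ω
  simp only [mem_partLE_insert, partLE_singleton, Finset.mem_insert, Finset.mem_singleton, forall_eq_or_imp, forall_eq,
    mem_univ, and_true, mem_inter_iff, mem_compl_iff]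
  simp [hd.2.1, hd.2.2.2.1, hd.2.2.2.2.2.symm, and_assoc]

omit [Fintype V] in
/-- `D(sc|a|b)`. [this work] -/
theorem partLE_blk5 (hd : s ≠ a ∧ s ≠ b ∧ s ≠ c ∧ a ≠ b ∧ a ≠ c ∧ b ≠ c) :
    partLE ({s, a, b, c} : Finset V) (fun v => if v = a then 1 else if v = b then 2 else (0 : ℕ)) =
      (openConn s a)ᶜ ∩ (openConn s b)ᶜ ∩ (openConn a b)ᶜ ∩ (openConn a c)ᶜ ∩ (openConn b c)ᶜ := by
  ext ω
  simp only [mem_partLE_insert, partLE_singleton, Finset.mem_insert, Finset.mem_singleton, forall_eq_or_imp, forall_eq,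
    mem_univ, and_true, mem_inter_iff, mem_compl_iff]
  simp [hd.1, hd.2.1, hd.2.2.2.1.symm, hd.2.2.2.2.1.symm, hd.2.2.2.2.2.symm, and_assoc]

omit [Fintype V] in
/-- `D(ac|s|b)`. [this work] -/
theorem partLE_blk6 (hd : s ≠ a ∧ s ≠ b ∧ s ≠ c ∧ a ≠ b ∧ a ≠ c ∧ b ≠ c) :
    partLE ({s, a, b, c} : Finset V) (fun v => if v = a ∨ v = c then 1 else if v = b then 2 else (0 : ℕ)) =
      (openConn s a)ᶜ ∩ (openConn s b)ᶜ ∩ (openConn s c)ᶜ ∩ (openConn a b)ᶜ ∩ (openConn b c)ᶜ := by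
  ext ω
  simp only [mem_partLE_insert, partLE_singleton, Finset.mem_insert, Finset.mem_singleton, forall_eq_or_imp, forall_eq,
    mem_univ, and_true, mem_inter_iff, mem_compl_iff]
  simp [hd.1, hd.2.1, hd.2.2.1, hd.2.2.2.1.symm, hd.2.2.2.2.2, and_assoc]

omit [Fintype V] in
/-- `D(c|sab)`: the port `c` isolated from `T = {s,a,b}` (the event `I` of `SuperTerminalQuarticFace`). [this work] -/
theorem partLE_blk7 (hd : s ≠ a ∧ s ≠ b ∧ s ≠ c ∧ a ≠ b ∧ a ≠ c ∧ b ≠ c) :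
    partLE ({s, a, b, c} : Finset V) (fun v => if v = c then 1 else (0 : ℕ)) =
      (openConn c s)ᶜ ∩ (openConn c a)ᶜ ∩ (openConn c b)ᶜ := by
  ext ω
  simp only [mem_partLE_insert, partLE_singleton, Finset.mem_insert, Finset.mem_singleton, forall_eq_or_imp, forall_eq,
    mem_univ, and_true, mem_inter_iff, mem_compl_iff]
  simp [hd.2.2.1, hd.2.2.2.2.1, hd.2.2.2.2.2, and_assoc, mem_openConn_comm]

omit [Fintype V] in
/-- Three-terminal `D(s|b|c)` for the labelling of `sa|b|c`. [this work] -/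
theorem partLE3_blk1 (hd : s ≠ a ∧ s ≠ b ∧ s ≠ c ∧ a ≠ b ∧ a ≠ c ∧ b ≠ c) :
    partLE ({s, b, c} : Finset V) (fun v => if v = b then 1 else if v = c then 2 else (0 : ℕ)) =
      (openConn s b)ᶜ ∩ (openConn s c)ᶜ ∩ (openConn b c)ᶜ := by
  ext ω
  simp only [mem_partLE_insert, partLE_singleton, Finset.mem_insert, Finset.mem_singleton, forall_eq_or_imp, forall_eq,
    mem_univ, and_true, mem_inter_iff, mem_compl_iff]
  simp [hd.2.1, hd.2.2.1, hd.2.2.2.2.2.symm, and_assoc]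

omit [Fintype V] in
/-- Three-terminal `D(s|bc)` for the labelling of `sa|bc`. [this work] -/
theorem partLE3_blk2 (hd : s ≠ a ∧ s ≠ b ∧ s ≠ c ∧ a ≠ b ∧ a ≠ c ∧ b ≠ c) :
    partLE ({s, b, c} : Finset V) (fun v => if v = b ∨ v = c then 1 else (0 : ℕ)) =
      (openConn s b)ᶜ ∩ (openConn s c)ᶜ := by
  ext ω
  simp only [mem_partLE_insert, partLE_singleton, Finset.mem_insert, Finset.mem_singleton, forall_eq_or_imp, forall_eq,
    mem_univ, and_true, mem_inter_iff, mem_compl_iff]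
  simp [hd.2.1, hd.2.2.1]

omit [Fintype V] in
/-- Three-terminal `D(sc|b)` for the labelling of `sac|b`. [this work] -/
theorem partLE3_blk4 (hd : s ≠ a ∧ s ≠ b ∧ s ≠ c ∧ a ≠ b ∧ a ≠ c ∧ b ≠ c) :
    partLE ({s, b, c} : Finset V) (fun v => if v = b then 1 else (0 : ℕ)) =
      (openConn s b)ᶜ ∩ (openConn b c)ᶜ := by
  ext ω
  simp only [mem_partLE_insert, partLE_singleton, Finset.mem_insert, Finset.mem_singleton, forall_eq_or_imp, forall_eq,
    mem_univ, and_true, mem_inter_iff, mem_compl_iff]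
  simp [hd.2.1, hd.2.2.2.2.2.symm]

omit [Fintype V] in
/-- Three-terminal `D(c|sb)` for the labelling of `c|sab`. [this work] -/
theorem partLE3_blk7 (hd : s ≠ a ∧ s ≠ b ∧ s ≠ c ∧ a ≠ b ∧ a ≠ c ∧ b ≠ c) :
    partLE ({s, b, c} : Finset V) (fun v => if v = c then 1 else (0 : ℕ)) =
      (openConn s c)ᶜ ∩ (openConn b c)ᶜ := by
  ext ω
  simp only [mem_partLE_insert, partLE_singleton, Finset.mem_insert, Finset.mem_singleton, forall_eq_or_imp, forall_eq,
    mem_univ, and_true, mem_inter_iff, mem_compl_iff]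
  simp [hd.2.2.1, hd.2.2.2.2.2]

/-! ## The laws `(T)` and `(Q6)_c` of the down-set vector of EVERY weighted graph -/

/-- **The tropical law `(T)` for every weight**: `D(sa|b|c)⁴ ≤ D(sa|bc)² · D(sac|b)² · D(c|sab)` — `(Q4)` of the graph with the
terminal pair `sa` made sure (`ThreePointIsoSexticAllGraphs.isoQuartic_graph`), whose three-terminal isolation events are the
four-terminal down-sets with `s, a` in one block (`real_partLE_update_one`). [this work] -/
theorem quartic_law (u : Sym2 V → unitInterval) (hd : s ≠ a ∧ s ≠ b ∧ s ≠ c ∧ a ≠ b ∧ a ≠ c ∧ b ≠ c) :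
    (prodBernoulli u).real ((openConn s b)ᶜ ∩ (openConn s c)ᶜ ∩ (openConn a b)ᶜ ∩ (openConn a c)ᶜ ∩ (openConn b c)ᶜ) ^ 4 ≤
      (prodBernoulli u).real ((openConn s b)ᶜ ∩ (openConn s c)ᶜ ∩ (openConn a b)ᶜ ∩ (openConn a c)ᶜ) ^ 2 *
        (prodBernoulli u).real ((openConn s b)ᶜ ∩ (openConn a b)ᶜ ∩ (openConn b c)ᶜ) ^ 2 *
          (prodBernoulli u).real ((openConn c s)ᶜ ∩ (openConn c a)ᶜ ∩ (openConn c b)ᶜ) := by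
  have h := ThreePointIsoSexticAllGraphs.isoQuartic_graph (Function.update u s(s, a) 1) s b c
  have hs : s ∈ ({s, b, c} : Finset V) := Finset.mem_insert_self _ _
  have hT : insert a ({s, b, c} : Finset V) = {s, a, b, c} := Finset.insert_comm a s {b, c}
  have e1 : (prodBernoulli (Function.update u s(s, a) 1)).real ((openConn s b)ᶜ ∩ (openConn s c)ᶜ ∩ (openConn b c)ᶜ) =
      (prodBernoulli u).real ((openConn s b)ᶜ ∩ (openConn s c)ᶜ ∩ (openConn a b)ᶜ ∩ (openConn a c)ᶜ ∩ (openConn b c)ᶜ) := by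
    conv_lhs => rw [← partLE3_blk1 hd]
    rw [real_partLE_update_one u hs (by simp [hd.2.1, hd.2.2.1, hd.2.2.2.1, hd.2.2.2.2.1]), hT, partLE_blk1 hd]
  have e2 : (prodBernoulli (Function.update u s(s, a) 1)).real ((openConn s b)ᶜ ∩ (openConn s c)ᶜ) =
      (prodBernoulli u).real ((openConn s b)ᶜ ∩ (openConn s c)ᶜ ∩ (openConn a b)ᶜ ∩ (openConn a c)ᶜ) := by
    conv_lhs => rw [← partLE3_blk2 hd]
    rw [real_partLE_update_one u hs (by simp [hd.2.1, hd.2.2.1, hd.2.2.2.1, hd.2.2.2.2.1]), hT, partLE_blk2 hd]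
  have e4 : (prodBernoulli (Function.update u s(s, a) 1)).real ((openConn s b)ᶜ ∩ (openConn b c)ᶜ) =
      (prodBernoulli u).real ((openConn s b)ᶜ ∩ (openConn a b)ᶜ ∩ (openConn b c)ᶜ) := by
    conv_lhs => rw [← partLE3_blk4 hd]
    rw [real_partLE_update_one u hs (by simp [hd.2.1, hd.2.2.2.1]), hT, partLE_blk4 hd]
  have e7 : (prodBernoulli (Function.update u s(s, a) 1)).real ((openConn s c)ᶜ ∩ (openConn b c)ᶜ) =
      (prodBernoulli u).real ((openConn c s)ᶜ ∩ (openConn c a)ᶜ ∩ (openConn c b)ᶜ) := by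
    conv_lhs => rw [← partLE3_blk7 hd]
    rw [real_partLE_update_one u hs (by simp [hd.2.2.1, hd.2.2.2.2.1]), hT, partLE_blk7 hd]
  rw [e1, e2, e4, e7] at h
  exact h.trans (le_of_eq (by ring))

/-- **The sextic law `(Q6)_c` for every weight**: `D(sa|b|c)⁶ ≤ D(c|sab)² · D(sa|bc)³ · D(sac|b)³` — the port component of `(Q6)`
(`ThreePointIsoSexticUniversal.isoSexticPort_all`) of the graph with `sa` made sure. [this work] -/
theorem sextic_law (u : Sym2 V → unitInterval) (hd : s ≠ a ∧ s ≠ b ∧ s ≠ c ∧ a ≠ b ∧ a ≠ c ∧ b ≠ c) :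
    (prodBernoulli u).real ((openConn s b)ᶜ ∩ (openConn s c)ᶜ ∩ (openConn a b)ᶜ ∩ (openConn a c)ᶜ ∩ (openConn b c)ᶜ) ^ 6 ≤
      (prodBernoulli u).real ((openConn c s)ᶜ ∩ (openConn c a)ᶜ ∩ (openConn c b)ᶜ) ^ 2 *
        (prodBernoulli u).real ((openConn s b)ᶜ ∩ (openConn s c)ᶜ ∩ (openConn a b)ᶜ ∩ (openConn a c)ᶜ) ^ 3 *
          (prodBernoulli u).real ((openConn s b)ᶜ ∩ (openConn a b)ᶜ ∩ (openConn b c)ᶜ) ^ 3 := by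
  have h := ThreePointIsoSexticUniversal.isoSexticPort_all (Function.update u s(s, a) 1) s b c
  have hs : s ∈ ({s, b, c} : Finset V) := Finset.mem_insert_self _ _
  have hT : insert a ({s, b, c} : Finset V) = {s, a, b, c} := Finset.insert_comm a s {b, c}
  have e1 : (prodBernoulli (Function.update u s(s, a) 1)).real ((openConn s b)ᶜ ∩ (openConn s c)ᶜ ∩ (openConn b c)ᶜ) =
      (prodBernoulli u).real ((openConn s b)ᶜ ∩ (openConn s c)ᶜ ∩ (openConn a b)ᶜ ∩ (openConn a c)ᶜ ∩ (openConn b c)ᶜ) := by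
    conv_lhs => rw [← partLE3_blk1 hd]
    rw [real_partLE_update_one u hs (by simp [hd.2.1, hd.2.2.1, hd.2.2.2.1, hd.2.2.2.2.1]), hT, partLE_blk1 hd]
  have e2 : (prodBernoulli (Function.update u s(s, a) 1)).real ((openConn s b)ᶜ ∩ (openConn s c)ᶜ) =
      (prodBernoulli u).real ((openConn s b)ᶜ ∩ (openConn s c)ᶜ ∩ (openConn a b)ᶜ ∩ (openConn a c)ᶜ) := by
    conv_lhs => rw [← partLE3_blk2 hd]
    rw [real_partLE_update_one u hs (by simp [hd.2.1, hd.2.2.1, hd.2.2.2.1, hd.2.2.2.2.1]), hT, partLE_blk2 hd]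
  have e4 : (prodBernoulli (Function.update u s(s, a) 1)).real ((openConn s b)ᶜ ∩ (openConn b c)ᶜ) =
      (prodBernoulli u).real ((openConn s b)ᶜ ∩ (openConn a b)ᶜ ∩ (openConn b c)ᶜ) := by
    conv_lhs => rw [← partLE3_blk4 hd]
    rw [real_partLE_update_one u hs (by simp [hd.2.1, hd.2.2.2.1]), hT, partLE_blk4 hd]
  have e7 : (prodBernoulli (Function.update u s(s, a) 1)).real ((openConn s c)ᶜ ∩ (openConn b c)ᶜ) =
      (prodBernoulli u).real ((openConn c s)ᶜ ∩ (openConn c a)ᶜ ∩ (openConn c b)ᶜ) := by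
    conv_lhs => rw [← partLE3_blk7 hd]
    rw [real_partLE_update_one u hs (by simp [hd.2.2.1, hd.2.2.2.2.1]), hT, partLE_blk7 hd]
  rw [e1, e2, e4, e7] at h
  exact h.trans (le_of_eq (by ring))

end Four

end Summit.CriticalPhenomena.PercolationContinuityZ3.Theorems.SuperTerminalDownsets
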